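import Literature.NumberTheory.EllipticCurves.DivisionFieldReducibleBorelKernel
import HarnessLib

/-!
# `Gal(K(χ₁, χ₂)/K)` is killed by `p − 1`: the Borel field of a stable line of a reducible `E[p]` has Galois group of exponent
# dividing `p − 1` (theorems only; no definition, no named fact)

Topic `NumberTheory/EllipticCurves` (namespace `WeierstrassCurve`, sibling of `DivisionFieldReducibleBorelKernel.lean` and
`DivisionFieldReducibleBorelIndex.lean`).  Written by the prover seat `bsd-potss-rkm` g37 (cell `bsd-potss`, item
stmt-BirchSwinnertonDyer-19196 `ReducibleKatoMember`, crux M of K9 / K8-t′; `--supports`, closes nothing).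

WHY.  For a `Γ_K`-stable line `C` of `E[p]` (`#C = p`, `#E[p] = p²`), `σ ∈ Γ_K` acts on `C` by a scalar `χ₁(σ) ∈ 𝔽_pˣ` and on `E[p]/C`
by a scalar `χ₂(σ) ∈ 𝔽_pˣ` (tree `exists_forall_smul_eq_zsmul_of_card_eq`, `exists_forall_smul_sub_zsmul_mem`), so `σ^{p−1}` acts
trivially on both (Fermat): `σ^{p−1} ∈ borelKernel C = Gal(K̄/K(χ₁,χ₂))`, i.e. `Gal(K(χ₁,χ₂)/K)` — already ABELIAN by the tree's
`isAbelianGalois_borelField` — has exponent dividing `p − 1`.  With `μ_p ⊆ K(χ₁,χ₂)` (`DivisionFieldReducibleBorelRootOfUnity`) this is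
exactly the hypothesis of the odd-character reflection descent `IwasawaTheory/ClassicalMuVanishesOddCharacterDescent.lean`: the
`μ`-input of Coates–Sujatha's (A) / Kato's member bound on a reducible row at `p` is `μ_p = 0` for the IMAGINARY CYCLIC subfields of
the Borel field `ℚ(χ₁, χ₂)` only.

* `pow_sub_one_mem_borelKernel` — `σ^{p−1} ∈ borelKernel C` for every `σ ∈ Γ_K`.
* `pow_sub_one_eq_one_of_gal_borelField`, `exponent_gal_borelField_dvd` — `g^{p−1} = 1` in `Gal(K(χ₁,χ₂)/K)` (`char K = 0`), i.e.
  `exp Gal(K(χ₁,χ₂)/K) ∣ p − 1`.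

References: [Serre1972] §4 (the Borel case `ρ̄ = (χ₁ *; 0 χ₂)`); [Wuthrich2014] Lemma 14 (p. 396); [SerreAbelianLadic1968] IV.1.1–1.2.
Design: no definition, no `instance`, no notation.  Axioms: `propext`, `Classical.choice`, `Quot.sound`.
-/

set_option autoImplicit false

noncomputable section

open scoped Classical
open Field IntermediateField Literature.NumberTheory.EllipticCurves Literature.NumberTheory.GaloisRepresentations

universe u

namespace WeierstrassCurve

variable {K : Type u} [Field K] (W : WeierstrassCurve K) {p : ℕ}

section Scalars

variable {W} [hp : Fact p.Prime] {C : AddSubgroup (W.geomTorsion (p : ℤ))}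

omit hp in
/-- `p • x = 0` on `E[p]`. [folklore] -/
private theorem p_zsmul_eq_zero' (x : W.geomTorsion (p : ℤ)) : (p : ℤ) • x = 0 := by
  apply Subtype.ext
  have hx : ((x : W.geomTorsion (p : ℤ)) : geomPoints W) ∈ AddSubgroup.torsionBy (geomPoints W) (p : ℤ) := x.2
  rw [AddSubgroup.torsionBy, Submodule.mem_toAddSubgroup, Submodule.mem_torsionBy_iff] at hx
  rw [AddSubgroupClass.coe_zsmul, ZeroMemClass.coe_zero]
  exact hx

omit hp in
/-- Congruent scalars act alike on `E[p]`. [folklore] -/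
private theorem zsmul_eq_zsmul_of_dvd_sub' {k k' : ℤ} (h : (p : ℤ) ∣ k - k') (x : W.geomTorsion (p : ℤ)) :
    k • x = k' • x := by
  obtain ⟨m, hm⟩ := h
  have : k = k' + p * m := by omega
  rw [this, add_smul, mul_comm, mul_smul, p_zsmul_eq_zero', smul_zero, add_zero]

omit hp in
/-- The Galois action commutes with integer scalars. [folklore] -/
private theorem smul_zsmul' (σ : absoluteGaloisGroup K) (k : ℤ) (x : W.geomTorsion (p : ℤ)) :
    σ • (k • x) = k • (σ • x) :=
  map_zsmul (DistribSMul.toAddMonoidHom (↥(W.geomTorsion (p : ℤ))) σ) k x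

omit hp in
/-- No `σ` kills the line `C ≠ 0`: the scalar `χ₁(σ)` is prime to `p`. [folklore] -/
private theorem not_dvd_scalar_line' (h1 : C ≠ ⊥) (σ : absoluteGaloisGroup K) {a : ℤ}
    (ha : ∀ x : W.geomTorsion (p : ℤ), x ∈ C → σ • x = a • x) : ¬ (p : ℤ) ∣ a := by
  intro hdvd
  apply h1
  rw [eq_bot_iff]
  intro c hc
  have hσc : σ • c = 0 := by
    rw [ha c hc, zsmul_eq_zsmul_of_dvd_sub' (k' := 0) (by simpa using hdvd), zero_smul]
  have : c = σ⁻¹ • (σ • c) := (inv_smul_smul σ c).symm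
  rw [this, hσc, smul_zero]
  exact AddSubgroup.mem_bot.mpr rfl

omit hp in
/-- No `σ` maps `E[p]` into `C ≠ E[p]`: the scalar `χ₂(σ)` is prime to `p`. [folklore] -/
private theorem not_dvd_scalar_quot' (h2 : C ≠ ⊤) (σ : absoluteGaloisGroup K) {b : ℤ}
    (hb : ∀ y : W.geomTorsion (p : ℤ), σ • y - b • y ∈ C) : ¬ (p : ℤ) ∣ b := by
  intro hdvd
  apply h2
  rw [eq_top_iff]
  intro y _
  have hσy : ∀ w : W.geomTorsion (p : ℤ), σ • w ∈ C := fun w => by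
    have h := hb w
    rwa [zsmul_eq_zsmul_of_dvd_sub' (k' := 0) (by simpa using hdvd), zero_smul, sub_zero] at h
  have : y = σ • (σ⁻¹ • y) := (smul_inv_smul σ y).symm
  rw [this]
  exact hσy _

omit hp in
/-- `σⁿ` acts on the line `C` by `χ₁(σ)ⁿ`. [cite: Serre1972, §4 (Borel image: the character χ₁ on the stable line)] -/
private theorem pow_smul_eq_of_line {σ : absoluteGaloisGroup K} {a : ℤ}
    (ha : ∀ x : W.geomTorsion (p : ℤ), x ∈ C → σ • x = a • x) (n : ℕ) :
    ∀ x : W.geomTorsion (p : ℤ), x ∈ C → σ ^ n • x = a ^ n • x := by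
  induction n with
  | zero => intro x _; rw [pow_zero, pow_zero, one_smul, one_smul]
  | succ n ih =>
    intro x hx
    rw [pow_succ, mul_smul, ha x hx, smul_zsmul', ih x hx, smul_smul, pow_succ']

omit hp in
/-- `σⁿ` acts on `E[p]/C` by `χ₂(σ)ⁿ`. [cite: Serre1972, §4 (Borel image: the character χ₂ on the quotient)] -/
private theorem pow_smul_sub_mem {σ : absoluteGaloisGroup K} {b : ℤ}
    (hC : ∀ (τ : absoluteGaloisGroup K) (x : W.geomTorsion (p : ℤ)), x ∈ C → τ • x ∈ C)
    (hb : ∀ y : W.geomTorsion (p : ℤ), σ • y - b • y ∈ C) (n : ℕ) :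
    ∀ y : W.geomTorsion (p : ℤ), σ ^ n • y - b ^ n • y ∈ C := by
  induction n with
  | zero => intro y; rw [pow_zero, pow_zero, one_smul, one_smul, sub_self]; exact C.zero_mem
  | succ n ih =>
    intro y
    have e1 : σ ^ n • (σ • y - b • y) ∈ C := hC _ _ (hb y)
    have e2 : b • (σ ^ n • y - b ^ n • y) ∈ C := C.zsmul_mem (ih y) b
    have key : σ ^ (n + 1) • y - b ^ (n + 1) • y = σ ^ n • (σ • y - b • y) + b • (σ ^ n • y - b ^ n • y) := by
      rw [pow_succ, mul_smul, smul_sub, smul_zsmul', smul_sub, smul_smul b (b ^ n), pow_succ']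
      abel
    rw [key]
    exact C.add_mem e1 e2

/-- **`σ^{p−1} ∈ borelKernel C` for every `σ ∈ Γ_K`** (`C` a `Γ_K`-stable line of `E[p]`, `#E[p] = p²`): `σ` acts on `C` and on
`E[p]/C` through scalars in `𝔽_pˣ`, which Fermat kills at the exponent `p − 1`.
[cite: Serre1972, §4 (Borel image ρ̄ = (χ₁ *; 0 χ₂) with χᵢ : Γ → 𝔽_pˣ)] [cite: SerreAbelianLadic1968, IV.1.1–1.2] -/
theorem pow_sub_one_mem_borelKernel
    (hC : ∀ (σ : absoluteGaloisGroup K) (x : W.geomTorsion (p : ℤ)), x ∈ C → σ • x ∈ C)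
    (h1 : C ≠ ⊥) (h2 : C ≠ ⊤) (hV : Nat.card (W.geomTorsion (p : ℤ)) = p ^ 2) (σ : absoluteGaloisGroup K) :
    σ ^ (p - 1) ∈ W.borelKernel C := by
  have hcard : Nat.card C = p := card_eq_of_ne_bot_of_ne_top hV h1 h2
  obtain ⟨a, ha⟩ := exists_forall_smul_eq_zsmul_of_card_eq hC hcard σ
  obtain ⟨b, hb⟩ := exists_forall_smul_sub_zsmul_mem hC hcard hV σ
  have hpr : Prime (p : ℤ) := Nat.prime_iff_prime_int.mp hp.out
  -- Fermat: `a^{p-1} ≡ 1`, `b^{p-1} ≡ 1 (mod p)`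
  have hfa : (p : ℤ) ∣ a ^ (p - 1) - 1 :=
    (Int.ModEq.pow_card_sub_one_eq_one hp.out
      ((Prime.coprime_iff_not_dvd hpr).mpr (not_dvd_scalar_line' h1 σ ha)).symm).symm.dvd
  have hfb : (p : ℤ) ∣ b ^ (p - 1) - 1 :=
    (Int.ModEq.pow_card_sub_one_eq_one hp.out
      ((Prime.coprime_iff_not_dvd hpr).mpr (not_dvd_scalar_quot' h2 σ hb)).symm).symm.dvd
  refine mem_borelKernel_iff.mpr ⟨fun x hx => ?_, fun y => ?_⟩
  · rw [pow_smul_eq_of_line ha (p - 1) x hx, zsmul_eq_zsmul_of_dvd_sub' hfa x, one_smul]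
  · have h3 := pow_smul_sub_mem hC hb (p - 1) y
    rwa [zsmul_eq_zsmul_of_dvd_sub' hfb y, one_smul] at h3

end Scalars

section Gal

variable {W} [CharZero K]

omit [CharZero K] in
/-- Restriction `Γ_K → Gal(E/K)` is onto for `E ⊆ K̄` normal over `K`. [folklore] -/
private theorem absRestrictNormalHom_surjective₄ (E : IntermediateField K (AlgebraicClosure K)) [Normal K E] :
    Function.Surjective (absRestrictNormalHom E) := fun g => by
  obtain ⟨σ, hσ⟩ := AlgEquiv.restrictNormalHom_surjective (AlgebraicClosure K) g
  exact ⟨(Field.absoluteGaloisGroup.toAlgEquiv K).symm σ, hσ⟩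

omit [CharZero K] in
/-- `((τ|_E) x : K̄) = τ • x`. [folklore] -/
private theorem coe_absRestrictNormalHom_apply₄ (E : IntermediateField K (AlgebraicClosure K)) [Normal K E]
    (τ : absoluteGaloisGroup K) (x : E) :
    ((absRestrictNormalHom E τ x : E) : AlgebraicClosure K) = τ • (x : AlgebraicClosure K) :=
  AlgEquiv.restrictNormalHom_apply E _ x

/-- **`Gal(K(χ₁, χ₂)/K)` is killed by `p − 1`**: every element of the Galois group of the Borel field of a stable line of `E[p]`
(`E` elliptic, `char K = 0`, `C ≠ 0, E[p]`) satisfies `g^{p−1} = 1` (it is a restriction of some `σ ∈ Γ_K`, and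
`σ^{p−1} ∈ borelKernel C = Gal(K̄/K(χ₁,χ₂))`). [cite: Serre1972, §4 (Borel image)] [cite: Wuthrich2014, Lemma 14 (p. 396)] -/
theorem pow_sub_one_eq_one_of_gal_borelField [W.IsElliptic] [hp : Fact p.Prime]
    {C : AddSubgroup (W.geomTorsion (p : ℤ))}
    (hC : ∀ (σ : absoluteGaloisGroup K) (x : W.geomTorsion (p : ℤ)), x ∈ C → σ • x ∈ C)
    (h1 : C ≠ ⊥) (h2 : C ≠ ⊤) (g : ↥(W.borelField C) ≃ₐ[K] ↥(W.borelField C)) : g ^ (p - 1) = 1 := by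
  haveI : NeZero p := ⟨hp.out.ne_zero⟩
  haveI : IsGalois K (W.borelField C) := isGalois_borelField hC
  have hV : Nat.card (W.geomTorsion (p : ℤ)) = p ^ 2 := W.natCard_geomTorsion_eq_sq_of_charZero hp.out
  obtain ⟨σ, rfl⟩ := absRestrictNormalHom_surjective₄ (W.borelField C) g
  rw [← map_pow]
  have hσ : σ ^ (p - 1) ∈ ((W.borelField C).fixingSubgroup : Subgroup (absoluteGaloisGroup K)) := by
    rw [fixingSubgroup_borelField]
    exact pow_sub_one_mem_borelKernel hC h1 h2 hV σ
  ext x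
  rw [coe_absRestrictNormalHom_apply₄, AlgEquiv.one_apply]
  exact (IntermediateField.mem_fixingSubgroup_iff (W.borelField C) (σ ^ (p - 1))).mp hσ x x.2

/-- **`exp Gal(K(χ₁, χ₂)/K) ∣ p − 1`** for the Borel field of a stable line of `E[p]` (`E` elliptic, `char K = 0`).  Together with
`isAbelianGalois_borelField` and `exists_isPrimitiveRoot_borelField`: `K(χ₁,χ₂)` is an abelian extension of exponent dividing `p − 1`
containing `μ_p` — every character of its Galois group is `𝔽_p`-valued. [cite: Serre1972, §4 (Borel image)] [cite: Wuthrich2014, Lemma 14 (p. 396)] -/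
theorem exponent_gal_borelField_dvd [W.IsElliptic] [hp : Fact p.Prime]
    {C : AddSubgroup (W.geomTorsion (p : ℤ))}
    (hC : ∀ (σ : absoluteGaloisGroup K) (x : W.geomTorsion (p : ℤ)), x ∈ C → σ • x ∈ C)
    (h1 : C ≠ ⊥) (h2 : C ≠ ⊤) :
    Monoid.exponent (↥(W.borelField C) ≃ₐ[K] ↥(W.borelField C)) ∣ p - 1 :=
  Monoid.exponent_dvd_of_forall_pow_eq_one fun g => pow_sub_one_eq_one_of_gal_borelField hC h1 h2 g

end Gal

end WeierstrassCurve

end
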